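import Literature.MathematicalPhysics.QuantumFieldTheory.Balaban1983to89.B14Sect3
import Literature.MathematicalPhysics.QuantumFieldTheory.Balaban1983to89.B14Eq364Beta

/-!
# `Balaban1983to89.B14Eq360TensorInvariance` — T. Bałaban, *Convergent renormalization expansions for lattice gauge
# theories*, Commun. Math. Phys. **119** (1988) 243–285 [Balaban1988Convergent]: (3.59) ⇒ (3.60) p. 282 — the invariance
# `((⊗⁴r)Π^{(j)})_{μν,κλ} = Π^{(j)}_{μν,κλ}` of the moment tensor under axis reflections and coordinate permutations, PROVED
# on the infinite lattice from the covariance (3.59) of the three-point kernel (and, for reflections, the vanishing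
# marginals (I.4.15)); whence (3.61) for the moment tensor by `B14Sect3.invariant_tensor_361`

statement-level skeleton of published theorems with citation tags; proofs where landed; nothing here is a claim about the Yang–Mills mass gap

PDF held: `paper:balaban1988-cmp119-convergent-renormalization` (journal page = PDF page + 242); p. 282 [PDF 40] read from the
OCR text layer and the x2 render `…-p040-x2.png` of the cell `pub-balaban` (symbols of (3.58)–(3.61) checked there by r11 gen 1–3).

CITATION HEADER (lean-in-tree rule).  WHAT IS REPRODUCED, verbatim, p. 282 [PDF 40]: *"[(3.58)] implies for the kernels in
(3.50): Π^{(j)}(rx, ry, rz) = (r ⊗ r)Π^{(j)}(x, y, z)(r⁻¹ ⊗ r⁻¹), (3.59) or Π^{(j)}_{μν}(rx, ry, rz) = Σ_{μ′,ν′} r_{μμ′} r_{νν′}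
Π^{(j)}_{μ′ν′}(x, y, z) r⁻¹_{μ′μ} r⁻¹_{ν′ν}, hence ((⊗⁴r)Π^{(j)})_{μν,κλ} = Π^{(j)}_{μν,κλ}. (3.60) Here r denotes the matrix of
the Euclidean rotation r. This invariance has the usual implications, analyzed already in Sect. 5 [I]. … Considering reflections
we conclude that in this case the coefficients in the sum are different from 0 only if μ = ν and κ = λ. Considering permutations
we conclude that then they are all equal"*, with (p. 281) `Π^{(j)}_{μν,κλ} = Σ_{x,y} Π^{(j)}_{μν}(x, y, z)(x_κ − z_κ)(y_λ − z_λ)` and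
(p. 282, on reflections) *"if r is the reflection in the hyperplane x_μ = 0, then (rB)_μ(x) = … = −B_μ((…, −x_μ − 1, …))"*.
SKELETON row **B14.Eq3.58–3.61** (owner r11): `B14Sect3.invariant_tensor_361` proves (3.60) ⇒ (3.61) for an abstract rank-4
array from the two invariances AS HYPOTHESES (`hrefl`, `hperm`); `B14Eq358Covariance` (p248899) proves (3.58) ⇒ (3.59) at the
level of the (3.50) kernel in the relabelling form `Π_{μν}(x, y) = sg(μ,x)sg(ν,y)Π(ρ(μ,x), ρ(ν,y))`; ROWS-B14 v1.19: *"the (3.60)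
contraction step stays the hypothesis of `invariant_tensor_361`"*.  THIS FILE proves that step.

THE MODEL (as in `B14Eq364Beta`): the whole lattice `L^{−j}Z^d` indexed by `Pt d = Fin d → ℤ`; the three-point kernel an
abstract `P3 : Fin d → Fin d → Pt d → Pt d → Pt d → ℝ`; the moment tensor `P4 P3 μ ν κ τ = Σ_{(x,y)∈Z^d×Z^d} Π_{μν}(x, y, 0) x_κ y_τ`
at the localization point `z = 0` (by translation invariance the printed tensor does not depend on `z`; `B14.Eq364Beta.betaPrime
P3 one two = P4 P3 two two one one`, `betaPrime_eq_P4`).  The hyperoctahedral covariances (3.59) at `z = 0` (the reflections and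
permutations FIX `0`) are HYPOTHESES in exactly the shape `B14.Eq358Covariance.kernel350_invariant_of_fix` delivers: for the
reflection `r_α` in the hyperplane `x_α = 0`, `Π_{μν}(x, y, 0) = s_α(μ)s_α(ν) Π_{μν}(r_{α,μ}x, r_{α,ν}y, 0)` where `s_α =
B14Sect3.axisSign α` and `r_{α,μ}x = r_αx − δ_{μα}e_α` is the SOURCE of the reflected bond `r⟨x, x+e_μ⟩` (the printed
`(…, −x_μ − 1, …)`; `reflSrc`, an involution); for a coordinate permutation `σ`, `Π_{μν}(x, y, 0) = Π_{σμ,σν}(σx, σy, 0)` with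
`(σx)_{σi} = x_i` (`permPt`).  RESULTS: `P4_perm` — permutation invariance of `P4` (pure re-indexing of `Z^d × Z^d`, no
summability needed); `P4_refl` — reflection invariance `P4 μνκτ = s(μ)s(ν)s(κ)s(τ)·P4 μνκτ`: re-indexing by the involution
`r_{α,μ} × r_{α,ν}` produces `(r_{α,μ}x)_κ = s_α(κ)(x_κ + δ_{μα}δ_{κα})`, and the bond-shift terms `δ·Σ_{x,y}Π(x,y,0)x_κ`,
`δ·Σ Π y_τ`, `δδ·Σ Π` VANISH by the marginal identities `Σ_x Π_{μν}(x, y, 0) = 0 = Σ_y Π_{μν}(x, y, 0)` ((I.4.15), the hypotheses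
already used for (3.62) in `B14.Eq364Beta.eq362a`), all interchanges justified by `Decay3` ((3.48)); `eq361_of_covariance` —
(3.61) for the moment tensor: on `κ < μ`, `τ < ν`, `P4 μνκτ = δ_{μν}δ_{κτ}·P4 μ₀μ₀κ₀κ₀`; `betaPrime_indep` — `β′_j` does not depend
on the choice of the two distinct axes.  HONEST NOTE: with lattice-point (not bond-midpoint) moments the printed (3.60) is exact
only modulo the marginal identities — made explicit here as hypotheses `hWx`, `hWy`; nothing is asserted about [I] Sect. 5.

Mega-formalization `lit-balaban`, unit `lit-balaban-r11` gen 4 (B14 fold owner), HOME `run/shared/lean/pub/lit-balaban/`.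

## References
* [Balaban1988Convergent] T. Bałaban, Commun. Math. Phys. 119 (1988) 243–285, (3.48) p.280, p.281, (3.58)–(3.61) p.282.
* [Balaban1987RG1] T. Bałaban, Commun. Math. Phys. 109 (1987) 249–301 ([I]: (4.15), Sect. 5).
-/

namespace Literature.MathematicalPhysics.QuantumFieldTheory.Balaban1983to89.B14.Eq360TensorInvariance

open _root_.Filter _root_.Topology Finset
open Literature.MathematicalPhysics.QuantumFieldTheory.GawedzkiKupiainen1985.PeriodicGleason
open Literature.MathematicalPhysics.QuantumFieldTheory.Balaban1983to89
open Literature.MathematicalPhysics.QuantumFieldTheory.Balaban1983to89.B14Sect3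
open Literature.MathematicalPhysics.QuantumFieldTheory.Balaban1983to89.B14.Eq364Beta

variable {d : ℕ}

/-! ## §1. The moment tensor at `z = 0` -/

/-- **The moment tensor** `Π^{(j)}_{μν,κλ} = Σ_{x,y} Π^{(j)}_{μν}(x, y, z)(x_κ − z_κ)(y_λ − z_λ)` (p. 281) at `z = 0`, as one sum
over `Z^d × Z^d`. [cite: Balaban1988Convergent, (3.57) p.281, (3.60) p.282] -/
noncomputable def P4 (P3 : Fin d → Fin d → Pt d → Pt d → Pt d → ℝ) (μ ν κ τ : Fin d) : ℝ :=
  ∑' q : Pt d × Pt d, P3 μ ν q.1 q.2 0 * ((q.1 κ : ℝ) * (q.2 τ : ℝ))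

/-- `β′_j = Π^{(j)}_{22,11}` (3.61) is the `(2,2,1,1)` entry of the moment tensor. [cite: Balaban1988Convergent, (3.61) p.282] -/
theorem betaPrime_eq_P4 (P3 : Fin d → Fin d → Pt d → Pt d → Pt d → ℝ) (one two : Fin d) :
    betaPrime P3 one two = P4 P3 two two one one := rfl

/-! ## §2. The point maps of the hyperoctahedral symmetries -/

/-- The source of the reflected `μ`-bond under the reflection `r_α` in the hyperplane `x_α = 0`: `r_{α,μ}x = r_αx − δ_{μα}e_α`,
coordinatewise `(r_{α,μ}x)_α = −x_α − δ_{μα}`, `(r_{α,μ}x)_i = x_i` (`i ≠ α`) — print: *"(rB)_μ(x) = −B_μ((…, −x_μ − 1, …))"* for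
`μ = α`. [cite: Balaban1988Convergent, (3.58) p.282] -/
def reflSrc (α μ : Fin d) (x : Pt d) : Pt d :=
  fun i => if i = α then -x i - (if μ = α then 1 else 0) else x i

/-- `r_{α,μ}` is an involution (`r_α e_α = −e_α`). [cite: Balaban1988Convergent, (3.58) p.282] -/
theorem reflSrc_reflSrc (α μ : Fin d) (x : Pt d) : reflSrc α μ (reflSrc α μ x) = x := by
  funext i
  unfold reflSrc
  by_cases hi : i = α
  · simp only [hi, if_true]
    ring
  · simp only [hi, if_false]

/-- `r_{α,μ}` as a permutation of `Z^d`. [cite: Balaban1988Convergent, (3.58) p.282] -/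
def reflSrcPerm (α μ : Fin d) : Equiv.Perm (Pt d) :=
  Function.Involutive.toPerm (reflSrc α μ) (reflSrc_reflSrc α μ)

/-- unfolding. [folklore] -/
private theorem reflSrcPerm_apply (α μ : Fin d) (x : Pt d) : reflSrcPerm α μ x = reflSrc α μ x := rfl

/-- The coordinates of `r_{α,μ}x` carry the sign `s_α(κ)` and the bond shift: `(r_{α,μ}x)_κ = s_α(κ)(x_κ + δ_{μα}δ_{κα})`.
[cite: Balaban1988Convergent, (3.58) p.282] -/
theorem reflSrc_coord (α μ : Fin d) (x : Pt d) (κ : Fin d) :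
    ((reflSrc α μ x κ : ℤ) : ℝ) = axisSign α κ * ((x κ : ℝ) + if (μ = α ∧ κ = α) then 1 else 0) := by
  unfold reflSrc axisSign
  by_cases hκ : κ = α
  · subst hκ
    by_cases hμ : μ = κ
    · simp [hμ]; ring
    · simp [hμ]
  · simp [hκ]

/-- A coordinate permutation `σ` acting on points so that `σe_i = e_{σi}`: `(σx)_i = x_{σ⁻¹i}`.
[cite: Balaban1988Convergent, (3.59) p.282] -/
def permPt (σ : Equiv.Perm (Fin d)) (x : Pt d) : Pt d := fun i => x (σ.symm i)

/-- `(σx)_{σκ} = x_κ` — the permutation acts on points so that `σe_κ = e_{σκ}`. [cite: Balaban1988Convergent, (3.59) p.282] -/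
theorem permPt_apply_perm (σ : Equiv.Perm (Fin d)) (x : Pt d) (κ : Fin d) : permPt σ x (σ κ) = x κ := by
  simp [permPt]

/-- `σ` as a permutation of `Z^d` (inverse `σ⁻¹`). [cite: Balaban1988Convergent, (3.59) p.282] -/
def permPtEquiv (σ : Equiv.Perm (Fin d)) : Equiv.Perm (Pt d) where
  toFun := permPt σ
  invFun := permPt σ.symm
  left_inv x := by funext i; simp [permPt]
  right_inv x := by funext i; simp [permPt]

/-- unfolding. [folklore] -/
private theorem permPtEquiv_apply (σ : Equiv.Perm (Fin d)) (x : Pt d) : permPtEquiv σ x = permPt σ x := rfl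

/-! ## §3. (3.59) ⇒ (3.60): permutations -/

variable {P3 : Fin d → Fin d → Pt d → Pt d → Pt d → ℝ} {C κ : ℝ}

/-- **(3.60) for coordinate permutations** from the covariance (3.59) at `z = 0`, `Π_{μν}(x, y, 0) = Π_{σμ,σν}(σx, σy, 0)`:
`Π_{σμ σν, σκ σλ} = Π_{μν,κλ}` — re-indexing `Z^d × Z^d` by `σ × σ` (no summability needed).
[cite: Balaban1988Convergent, (3.59)–(3.60) p.282] -/
theorem P4_perm (hP : ∀ (σ : Equiv.Perm (Fin d)) μ ν x y, P3 μ ν x y 0 = P3 (σ μ) (σ ν) (permPt σ x) (permPt σ y) 0)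
    (σ : Equiv.Perm (Fin d)) (μ ν κ τ : Fin d) : P4 P3 (σ μ) (σ ν) (σ κ) (σ τ) = P4 P3 μ ν κ τ := by
  unfold P4
  let e : Pt d × Pt d ≃ Pt d × Pt d := Equiv.prodCongr (permPtEquiv σ) (permPtEquiv σ)
  rw [← e.tsum_eq (fun q : Pt d × Pt d => P3 (σ μ) (σ ν) q.1 q.2 0 * ((q.1 (σ κ) : ℝ) * (q.2 (σ τ) : ℝ)))]
  refine tsum_congr fun q => ?_
  simp only [e, Equiv.prodCongr_apply, Prod.map, permPtEquiv_apply, permPt_apply_perm]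
  rw [← hP σ μ ν q.1 q.2]

/-! ## §4. (3.59) ⇒ (3.60): reflections (with the marginal identities) -/

/-- `1 ≤ Π_{j∈t} f j` for real factors `≥ 1`. [folklore] -/
private theorem one_le_prod_real {ι : Type*} (t : Finset ι) (f : ι → ℝ) (hf : ∀ j ∈ t, 1 ≤ f j) :
    1 ≤ ∏ j ∈ t, f j := by
  calc (1:ℝ) = ∏ _j ∈ t, (1:ℝ) := Finset.prod_const_one.symm
    _ ≤ ∏ j ∈ t, f j := Finset.prod_le_prod (fun _ _ => zero_le_one) hf

/-- `1 ≤ pw 1 x`. [folklore] -/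
private theorem one_le_pw_one (x : Pt d) : 1 ≤ pw 1 x := by
  unfold pw
  exact one_le_prod_real _ _ fun j _ => by rw [pow_one]; linarith [abs_nonneg (x j : ℝ)]

/-- `|x_κ| ≤ pw 1 x`. [folklore] -/
private theorem abs_coord_le_pw_one (x : Pt d) (κ : Fin d) : |(x κ : ℝ)| ≤ pw 1 x := by
  classical
  unfold pw
  rw [← Finset.mul_prod_erase Finset.univ (fun j => (|(x j : ℝ)| + 1) ^ 1) (Finset.mem_univ κ)]
  have h1 := one_le_prod_real (Finset.univ.erase κ) (fun j => (|(x j : ℝ)| + 1) ^ 1)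
    (fun j _ => by rw [pow_one]; linarith [abs_nonneg (x j : ℝ)])
  rw [pow_one]
  nlinarith [abs_nonneg (x κ : ℝ)]

/-- The four absolutely convergent sums behind (3.60): `Σ Π x_κy_τ`, `Σ Π x_κ`, `Σ Π y_τ`, `Σ Π` (`Decay3`).
[cite: Balaban1988Convergent, (3.48) p.280, (3.60) p.282] -/
theorem summable_moment11 (hD : Decay3 P3 C κ) (hκ : 0 < κ) (μ ν κ' τ : Fin d) :
    Summable fun q : Pt d × Pt d => P3 μ ν q.1 q.2 0 * ((q.1 κ' : ℝ) * (q.2 τ : ℝ)) :=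
  hD.summable_mul hκ μ ν 1 fun q => by
    rw [abs_mul]
    exact mul_le_mul (abs_coord_le_pw_one _ _) (abs_coord_le_pw_one _ _) (abs_nonneg _) (pw_pos 1 _).le

/-- `Σ_{x,y} Π(x,y,0) x_κ` converges absolutely. [cite: Balaban1988Convergent, (3.48) p.280] -/
theorem summable_moment10 (hD : Decay3 P3 C κ) (hκ : 0 < κ) (μ ν κ' : Fin d) :
    Summable fun q : Pt d × Pt d => P3 μ ν q.1 q.2 0 * (q.1 κ' : ℝ) :=
  hD.summable_mul hκ μ ν 1 fun q =>
    (abs_coord_le_pw_one q.1 κ').trans (le_mul_of_one_le_right (pw_pos 1 _).le (one_le_pw_one _))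

/-- `Σ_{x,y} Π(x,y,0) y_τ` converges absolutely. [cite: Balaban1988Convergent, (3.48) p.280] -/
theorem summable_moment01 (hD : Decay3 P3 C κ) (hκ : 0 < κ) (μ ν τ : Fin d) :
    Summable fun q : Pt d × Pt d => P3 μ ν q.1 q.2 0 * (q.2 τ : ℝ) :=
  hD.summable_mul hκ μ ν 1 fun q =>
    (abs_coord_le_pw_one q.2 τ).trans (le_mul_of_one_le_left (pw_pos 1 _).le (one_le_pw_one _))

/-- `Σ_{x,y} Π(x,y,0)` converges absolutely. [cite: Balaban1988Convergent, (3.48) p.280] -/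
theorem summable_moment00 (hD : Decay3 P3 C κ) (hκ : 0 < κ) (μ ν : Fin d) :
    Summable fun q : Pt d × Pt d => P3 μ ν q.1 q.2 0 := by
  have h := hD.summable_mul hκ μ ν 0 (w := fun _ => (1:ℝ)) fun q => by simp [pw]
  simpa using h

/-- `Σ_{x,y} Π(x,y,0) x_κ = Σ_x x_κ Σ_y Π(x,y,0) = 0` by the `y`-marginal identity. [cite: Balaban1988Convergent, (3.62) p.282] -/
theorem moment10_eq_zero (hD : Decay3 P3 C κ) (hκ : 0 < κ) (μ ν κ' : Fin d) (hWy : ∀ x, ∑' y, P3 μ ν x y 0 = 0) :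
    ∑' q : Pt d × Pt d, P3 μ ν q.1 q.2 0 * (q.1 κ' : ℝ) = 0 := by
  rw [(summable_moment10 hD hκ μ ν κ').tsum_prod' (fun x => ((hD.summable_fibre_y hκ μ ν x 0 (w := fun _ => (1:ℝ))
    (fun y => by simp)).mul_right ((x κ' : ℝ))).congr fun y => by ring)]
  refine (tsum_congr fun x => ?_).trans tsum_zero
  show ∑' y, P3 μ ν x y 0 * (x κ' : ℝ) = 0
  rw [tsum_mul_right, hWy x, zero_mul]

/-- `Σ_{x,y} Π(x,y,0) y_τ = Σ_y y_τ Σ_x Π(x,y,0) = 0` by the `x`-marginal identity. [cite: Balaban1988Convergent, (3.62) p.282] -/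
theorem moment01_eq_zero (hD : Decay3 P3 C κ) (hκ : 0 < κ) (μ ν τ : Fin d) (hWx : ∀ y, ∑' x, P3 μ ν x y 0 = 0) :
    ∑' q : Pt d × Pt d, P3 μ ν q.1 q.2 0 * (q.2 τ : ℝ) = 0 := by
  have hsw : Summable fun q : Pt d × Pt d => P3 μ ν q.2 q.1 0 * (q.1 τ : ℝ) :=
    (Equiv.prodComm (Pt d) (Pt d)).summable_iff.mpr (summable_moment01 hD hκ μ ν τ) |>.congr fun q => by simp
  rw [← (Equiv.prodComm (Pt d) (Pt d)).tsum_eq (fun q : Pt d × Pt d => P3 μ ν q.1 q.2 0 * (q.2 τ : ℝ))]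
  simp only [Equiv.prodComm_apply, Prod.fst_swap, Prod.snd_swap]
  rw [hsw.tsum_prod' (fun y => ((hD.summable_fibre_x hκ μ ν y 0 (w := fun _ => (1:ℝ))
    (fun x => by simp)).mul_right ((y τ : ℝ))).congr fun x => by ring)]
  refine (tsum_congr fun y => ?_).trans tsum_zero
  show ∑' x, P3 μ ν x y 0 * (y τ : ℝ) = 0
  rw [tsum_mul_right, hWx y, zero_mul]

/-- `Σ_{x,y} Π(x,y,0) = 0` by the `y`-marginal identity. [cite: Balaban1988Convergent, (3.62) p.282] -/
theorem moment00_eq_zero (hD : Decay3 P3 C κ) (hκ : 0 < κ) (μ ν : Fin d) (hWy : ∀ x, ∑' y, P3 μ ν x y 0 = 0) :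
    ∑' q : Pt d × Pt d, P3 μ ν q.1 q.2 0 = 0 := by
  rw [(summable_moment00 hD hκ μ ν).tsum_prod' (fun x => (hD.summable_fibre_y hκ μ ν x 0 (w := fun _ => (1:ℝ))
    (fun y => by simp)).congr fun y => by ring)]
  refine (tsum_congr fun x => ?_).trans tsum_zero
  exact hWy x

/-- Step 1 of the reflection argument: by (3.59) and re-indexing with the involution `r_{α,μ} × r_{α,ν}`,
`Π_{μν,κτ} = s(μ)s(ν) Σ_{x,y} Π_{μν}(x, y, 0)(r_{α,μ}x)_κ (r_{α,ν}y)_τ`. [cite: Balaban1988Convergent, (3.59)–(3.60) p.282] -/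
theorem P4_refl_reindex
    (hR : ∀ α μ ν x y, P3 μ ν x y 0 = axisSign α μ * axisSign α ν * P3 μ ν (reflSrc α μ x) (reflSrc α ν y) 0)
    (α μ ν κ' τ : Fin d) :
    P4 P3 μ ν κ' τ = axisSign α μ * axisSign α ν *
      ∑' q : Pt d × Pt d, P3 μ ν q.1 q.2 0 * (((reflSrc α μ q.1 κ' : ℤ) : ℝ) * ((reflSrc α ν q.2 τ : ℤ) : ℝ)) := by
  unfold P4
  let e : Pt d × Pt d ≃ Pt d × Pt d := Equiv.prodCongr (reflSrcPerm α μ) (reflSrcPerm α ν)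
  rw [← tsum_mul_left, ← e.tsum_eq (fun q : Pt d × Pt d => axisSign α μ * axisSign α ν *
    (P3 μ ν q.1 q.2 0 * (((reflSrc α μ q.1 κ' : ℤ) : ℝ) * ((reflSrc α ν q.2 τ : ℤ) : ℝ))))]
  refine tsum_congr fun q => ?_
  simp only [e, Equiv.prodCongr_apply, Prod.map, reflSrcPerm_apply, reflSrc_reflSrc]
  rw [hR α μ ν q.1 q.2]
  ring

/-- `s_α(i)² = 1`. [folklore] -/
private theorem axisSign_mul_self (α i : Fin d) : axisSign α i * axisSign α i = 1 := by
  unfold axisSign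
  split_ifs <;> norm_num

/-- **(3.60) for axis reflections** from the covariance (3.59) at `z = 0` in the bond form
`Π_{μν}(x, y, 0) = s_α(μ)s_α(ν)Π_{μν}(r_{α,μ}x, r_{α,ν}y, 0)` and the marginal identities (I.4.15):
`Π_{μν,κτ} = s_α(μ)s_α(ν)s_α(κ)s_α(τ)·Π_{μν,κτ}` — the hypothesis `hrefl` of `B14Sect3.invariant_tensor_361`.
[cite: Balaban1988Convergent, (3.59)–(3.60) p.282] -/
theorem P4_refl (hD : Decay3 P3 C κ) (hκ : 0 < κ)
    (hWx : ∀ μ ν y, ∑' x, P3 μ ν x y 0 = 0) (hWy : ∀ μ ν x, ∑' y, P3 μ ν x y 0 = 0)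
    (hR : ∀ α μ ν x y, P3 μ ν x y 0 = axisSign α μ * axisSign α ν * P3 μ ν (reflSrc α μ x) (reflSrc α ν y) 0)
    (α μ ν κ' τ : Fin d) :
    P4 P3 μ ν κ' τ = axisSign α μ * axisSign α ν * axisSign α κ' * axisSign α τ * P4 P3 μ ν κ' τ := by
  conv_lhs => rw [P4_refl_reindex hR α μ ν κ' τ]
  -- the coordinates of the reflected sources
  set a : ℝ := if (μ = α ∧ κ' = α) then 1 else 0 with ha
  set b : ℝ := if (ν = α ∧ τ = α) then 1 else 0 with hb
  have hcoord : ∀ q : Pt d × Pt d,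
      P3 μ ν q.1 q.2 0 * (((reflSrc α μ q.1 κ' : ℤ) : ℝ) * ((reflSrc α ν q.2 τ : ℤ) : ℝ))
        = axisSign α κ' * axisSign α τ * (P3 μ ν q.1 q.2 0 * ((q.1 κ' : ℝ) * (q.2 τ : ℝ))
          + b * (P3 μ ν q.1 q.2 0 * (q.1 κ' : ℝ)) + a * (P3 μ ν q.1 q.2 0 * (q.2 τ : ℝ))
          + a * b * P3 μ ν q.1 q.2 0) := by
    intro q
    rw [reflSrc_coord, reflSrc_coord, ← ha, ← hb]
    ring
  rw [tsum_congr hcoord, tsum_mul_left]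
  have hxy := summable_moment11 hD hκ μ ν κ' τ
  have hx := summable_moment10 hD hκ μ ν κ'
  have hy := summable_moment01 hD hκ μ ν τ
  have h0 := summable_moment00 hD hκ μ ν
  rw [Summable.tsum_add ((hxy.add (hx.mul_left b)).add (hy.mul_left a)) (h0.mul_left (a * b)),
    Summable.tsum_add (hxy.add (hx.mul_left b)) (hy.mul_left a), Summable.tsum_add hxy (hx.mul_left b),
    tsum_mul_left, tsum_mul_left, tsum_mul_left, moment10_eq_zero hD hκ μ ν κ' (hWy μ ν),
    moment01_eq_zero hD hκ μ ν τ (hWx μ ν), moment00_eq_zero hD hκ μ ν (hWy μ ν)]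
  simp only [P4]
  ring

/-! ## §5. (3.61) for the moment tensor -/

/-- **(3.59) ⇒ (3.60) ⇒ (3.61)** on the infinite lattice: for a decaying three-point kernel with the marginal identities and the
hyperoctahedral covariances (3.59) at `z = 0`, the moment tensor satisfies, on the indices `κ < μ`, `τ < ν` of the sum (3.57),
`Π_{μν,κτ} = δ_{μν}δ_{κτ}·Π_{μ₀μ₀,κ₀κ₀}` for any fixed `κ₀ ≠ μ₀` — *"different from 0 only if μ = ν and κ = λ … then they are all
equal"* (`B14Sect3.invariant_tensor_361` with both hypotheses DISCHARGED). [cite: Balaban1988Convergent, (3.59)–(3.61) p.282] -/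
theorem eq361_of_covariance (hD : Decay3 P3 C κ) (hκ : 0 < κ)
    (hWx : ∀ μ ν y, ∑' x, P3 μ ν x y 0 = 0) (hWy : ∀ μ ν x, ∑' y, P3 μ ν x y 0 = 0)
    (hR : ∀ α μ ν x y, P3 μ ν x y 0 = axisSign α μ * axisSign α ν * P3 μ ν (reflSrc α μ x) (reflSrc α ν y) 0)
    (hP : ∀ (σ : Equiv.Perm (Fin d)) μ ν x y, P3 μ ν x y 0 = P3 (σ μ) (σ ν) (permPt σ x) (permPt σ y) 0)
    {μ₀ κ₀ : Fin d} (h₀ : κ₀ ≠ μ₀) :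
    ∀ μ ν κ' τ, κ' < μ → τ < ν →
      P4 P3 μ ν κ' τ = if (μ = ν ∧ κ' = τ) then P4 P3 μ₀ μ₀ κ₀ κ₀ else 0 :=
  invariant_tensor_361 (P4 P3) (fun α μ ν κ' τ => P4_refl hD hκ hWx hWy hR α μ ν κ' τ)
    (fun σ μ ν κ' τ => P4_perm hP σ μ ν κ' τ) h₀

/-- **(3.61), "they are all equal"**: `β′_j = Π^{(j)}_{22,11}` computed with ANY pair of distinct axes `one < two` gives the same
number (any dimension `d`). [cite: Balaban1988Convergent, (3.61) p.282] -/
theorem betaPrime_indep (hD : Decay3 P3 C κ) (hκ : 0 < κ)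
    (hWx : ∀ μ ν y, ∑' x, P3 μ ν x y 0 = 0) (hWy : ∀ μ ν x, ∑' y, P3 μ ν x y 0 = 0)
    (hR : ∀ α μ ν x y, P3 μ ν x y 0 = axisSign α μ * axisSign α ν * P3 μ ν (reflSrc α μ x) (reflSrc α ν y) 0)
    (hP : ∀ (σ : Equiv.Perm (Fin d)) μ ν x y, P3 μ ν x y 0 = P3 (σ μ) (σ ν) (permPt σ x) (permPt σ y) 0)
    {one two one' two' : Fin d} (h12 : one < two) (h12' : one' < two') :
    betaPrime P3 one two = betaPrime P3 one' two' := by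
  rw [betaPrime_eq_P4, betaPrime_eq_P4,
    eq361_of_covariance hD hκ hWx hWy hR hP (μ₀ := two') (κ₀ := one') h12'.ne two two one one h12 h12,
    if_pos ⟨rfl, rfl⟩]

/-- **The off-diagonal entries vanish**: for `κ < μ`, `τ < ν` and `¬(μ = ν ∧ κ = τ)`, `Π_{μν,κτ} = 0` (*"Considering reflections
…"*; only `hR` and the marginals are used). [cite: Balaban1988Convergent, (3.60)–(3.61) p.282] -/
theorem P4_offdiag_eq_zero (hD : Decay3 P3 C κ) (hκ : 0 < κ)
    (hWx : ∀ μ ν y, ∑' x, P3 μ ν x y 0 = 0) (hWy : ∀ μ ν x, ∑' y, P3 μ ν x y 0 = 0)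
    (hR : ∀ α μ ν x y, P3 μ ν x y 0 = axisSign α μ * axisSign α ν * P3 μ ν (reflSrc α μ x) (reflSrc α ν y) 0)
    {μ ν κ' τ : Fin d} (hκμ : κ' < μ) (hτν : τ < ν) (hne : ¬(μ = ν ∧ κ' = τ)) : P4 P3 μ ν κ' τ = 0 :=
  refl_invariant_vanish (P4 P3) (fun α μ ν κ' τ => P4_refl hD hκ hWx hWy hR α μ ν κ' τ) hκμ hτν hne

end Literature.MathematicalPhysics.QuantumFieldTheory.Balaban1983to89.B14.Eq360TensorInvariance
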